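import Literature.AnabelianGeometry.EtaleTheta.Discharge.Sec3Example39ivCuspidallyPureAtGenuineBase

/-!
# [EtTh] Example 3.9 (iv) «`Φ_α^ell` is cuspidally pure» (F-0615) at the TEXT'S OWN (i)-instance `X = Ċ`, arrows `Ẋ → Ċ`, over `B^temp(Π^tp_Ċ)⁰` (p. 309 / PDF p. 83; p. 311 / PDF p. 85)

S. Mochizuki, *The étale theta function and its Frobenioid-theoretic manifestations*, Publ. RIMS **45** (2009), Example 3.9 (i), PDF p. 83:
«[Thus, for instance, when `X^log` is "`Ċ^log`", one may take the upper arrow of the diagram to be "`Ẋ^log → Ċ^log`" and the lower arrow of the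
diagram to be "`Ẋ^log → Ċ^log`".]»; (iv) p. 85: «`Φ_α^ell := Φ_W^ell|_{D_α}` … cuspidally pure».
[cite: MochizukiEtTh2009, Ex 3.9 (i) p.309 (PDF p.83); Ex 3.9 (iv) p.311 (PDF p.85); Def 3.6 (v) p.304 (PDF p.78)]

PROOF-ONLY sequel (no `def`, no instance, no new named fact) of this seat's `Discharge/Sec3Example39ivCuspidallyPureAtGenuineBase.lean`
(p482977; abc-iut cell, layer L2, seat abc-iut-w6-d047 gen 4, L2-lead R858/R879 «EX39-CUSP-PURE@GENUINE / EX39-DATUM BRIDGE», offer (x1)):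
the bridge `TemperedFrobenioid.example39_iv_cuspidallyPure_ofRankOneObjectConnectedPart` INSTANTIATED at abc-iut-w6-d059's TEXT INSTANCE of the
Example 3.9 (i) square (`ThetaFrobenioidInducedBaseSquare.lean`, `nonempty_example39Data_dotC`): the Def. 2.5 tempered tower `T : TemperedCoverData`
(abc-iut-L2-t2: `Π^tp_C ⊇ Π^tp_Ċ`, `Π^tp_Ẋ := Π^tp_X ∩ Π^tp_Ċ`), `D_W := B^temp(Π^tp_Ċ)⁰`, `D_U = D_Y := B^temp(Π^tp_Ẋ)⁰`, `D_X := B^temp(Π^tp_Ċ)⁰`,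
both non-identity arrows the induction functor of `Π^tp_Ẋ ↪ Π^tp_Ċ`; (ii) read degenerately (`D^ell := D`); (iii) := the rank-one engine of
record over `B^temp(Π^tp_Ċ)⁰` (`ofRankOneObjectConnectedPart`, any Def. 3.3 (iii) datum with a rank-one object).  RESULT
`ThetaCovers.TemperedCoverData.example39_iv_cuspidallyPure_dotC_ofRankOneObject`: F-0615 HOLDS there for every arrow `α` of `B^temp(Π^tp_Ċ)⁰` —
the only hypothesis is print's standing one, `Π^tp_C` tempered ([SemiAnbd] Def. 3.1 (i)).  HONEST LABEL as in the parent file: (iii) is a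
CONSTRUCTED rank-one divisor monoid (Def. 3.6 (v)(b) one-sided by construction), not the tempered Frobenioid of a Tate curve; nothing here bears
on [IUTchIII] Cor. 3.12; typed ≠ proved; no side taken. [claim: MochizukiEtTh2009, status: refereed pre-IUT]
-/

noncomputable section

namespace Literature.AnabelianGeometry.EtaleTheta

open CategoryTheory Opposite Literature.AlgebraicGeometry.Frobenioids Literature.AlgebraicGeometry.Frobenioids.QuasiTemperoid
  Literature.AnabelianGeometry.SemiGraphs Literature.AlgebraicGeometry.Frobenioids.QuasiTemperoid.BTempConnected

universe u₀ v₀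

namespace ThetaCovers.TemperedCoverData

open Example39BaseSquare

variable {l : ℕ} (T : TemperedCoverData.{0} l) (hT : IsTempered T.Gtp)
  {D₀ : Type u₀} [Category.{v₀} D₀] {dm : DivisorMonoids.{u₀, v₀, 0} D₀} (P : dm.RankOneObject)
  (hpf : ∀ Y : D₀ᵒᵖ, IsPerfFactorialCof (dm.Φ₀.obj Y)) (R S : ((Discrete PUnit.{1})ᵒᵖ ⥤ CommMonCat.{0}) → Prop)
  (R' S' : ((ConnectedPart (BTemp ↥T.PiCdot))ᵒᵖ ⥤ CommMonCat.{0}) → Prop)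
  {A B : ConnectedPart (BTemp ↥T.PiCdot)} (α : A ⟶ B)
  (IsRationalα IsStrictlyRationalα : ((Example39Data.Dα α)ᵒᵖ ⥤ CommMonCat.{0}) → Prop)

/-- **F-0615 at the text's instance `X = Ċ`, arrows `Ẋ → Ċ`, over `D_W = B^temp(Π^tp_Ċ)⁰`** (Example 3.9 (i) bracketed instance; (ii) degenerate;
(iii) := the rank-one engine of record), for every arrow `α` of `B^temp(Π^tp_Ċ)⁰`; hypothesis: `Π^tp_C` tempered.
[cite: MochizukiEtTh2009, Ex 3.9 (i) p.309 (PDF p.83); Ex 3.9 (iv) p.311 (PDF p.85)] -/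
theorem example39_iv_cuspidallyPure_dotC_ofRankOneObject :
    (Example39Data.ofInducedSquare T.dotXToDotC (MonoidHom.id _) (MonoidHom.id _) T.dotXToDotC
      (isOpenMap_dotXToDotC T) IsOpenMap.id IsOpenMap.id (isOpenMap_dotXToDotC T)
      (continuous_dotXToDotC T) continuous_id continuous_id (continuous_dotXToDotC T)
      (countable_quotient_PiCdot T hT) (countable_quotient_dotX T hT) (countable_quotient_PiCdot T hT)
      (by rw [MonoidHom.id_comp, MonoidHom.comp_id]) treeMonoidVocabWeak.{0}
      ((RealifiedDivisorMonoids.ofRlfZWeak dm hpf).precomp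
        (TemperedFrobenioid.ofRankOneObjectConnectedPart P hpf R S ↥T.PiCdot R' S').base)
      ⊤ (ObjectProperty.topEquivalence _).inverse (ObjectProperty.topEquivalence _).symm.toAdjunction
      ⊤ (ObjectProperty.topEquivalence _).inverse (ObjectProperty.topEquivalence _).symm.toAdjunction
      (TemperedFrobenioid.ofRankOneObjectConnectedPart P hpf R S ↥T.PiCdot R' S').Φ
      (TemperedFrobenioid.isPerfect_Φ_ofRankOneObjectConnectedPart P hpf R S ↥T.PiCdot R' S')
      (TemperedFrobenioid.ofRankOneObjectConnectedPart P hpf R S ↥T.PiCdot R' S').isGroupSaturated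
      (TemperedFrobenioid.ofRankOneObjectConnectedPart P hpf R S ↥T.PiCdot R' S').isPerfFactorial
      (TemperedFrobenioid.isNonDilating_pull_ofRankOneObjectConnectedPart P hpf R S ↥T.PiCdot R' S')).Example39_iv_cuspidallyPure α
      (Example39Data.frobenioidHyp_ofInducedSquare_ofTempered T.dotXToDotC (MonoidHom.id _) (MonoidHom.id _) T.dotXToDotC
        (isOpenMap_dotXToDotC T) IsOpenMap.id IsOpenMap.id (isOpenMap_dotXToDotC T)
        (continuous_dotXToDotC T) continuous_id continuous_id (continuous_dotXToDotC T)
        (countable_quotient_PiCdot T hT) (countable_quotient_dotX T hT) (countable_quotient_PiCdot T hT)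
        (by rw [MonoidHom.id_comp, MonoidHom.comp_id])
        ⊤ (ObjectProperty.topEquivalence _).inverse (ObjectProperty.topEquivalence _).symm.toAdjunction
        ⊤ (ObjectProperty.topEquivalence _).inverse (ObjectProperty.topEquivalence _).symm.toAdjunction
        (TemperedFrobenioid.ofRankOneObjectConnectedPart P hpf R S ↥T.PiCdot R' S')
        (TemperedFrobenioid.isPerfect_Φ_ofRankOneObjectConnectedPart P hpf R S ↥T.PiCdot R' S')
        (TemperedFrobenioid.isNonDilating_pull_ofRankOneObjectConnectedPart P hpf R S ↥T.PiCdot R' S') α IsRationalα IsStrictlyRationalα) :=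
  TemperedFrobenioid.example39_iv_cuspidallyPure_ofRankOneObjectConnectedPart P hpf R S _ R' S' _ _ _ _ _ _ _ _ _ _ _ _ _ _ _ _ _ _ _ _
    _ _ α IsRationalα IsStrictlyRationalα

end ThetaCovers.TemperedCoverData

end Literature.AnabelianGeometry.EtaleTheta

end
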